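import Summits.Schanuel.Schanuel.Theorems.ZilberEacLogTranscendence
import Summits.Schanuel.Schanuel.Theorems.ZilberEacGrowthDensity
import Mathlib.Analysis.SpecialFunctions.ExpDeriv
import HarnessLib

/-!
# The equimodular class, III: `exp(κ + 2c(z - τ)L - cL²)` is transcendental over `ℂ(z)` for a
# primitive `L` of the logarithmic derivative of a non-constant rational function

HONEST FRAMING.  Cell `pub-schanuel` (Zilber's Exponential-Algebraic Closedness, case ladder;
host summit Schanuel), seat 2, gen 22.  The algebraic heart of the TRANSCENDENCE mechanism for
the resonant degenerate members of the equimodular class: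
**`not_algebraic_resonantExp`** — with `A, B, a, L, z₀` as in file II and `c ≠ 0`, the function
`w(z) = exp(κ + 2c(z - τ)L(z) - cL(z)²)` satisfies NO nonzero relation `H(z, w z) = 0` near `z₀`.
Proof (in the domain `AGerm z₀` of file I): take `H` of minimal `t`-degree `M ≥ 1`; differentiating
`H(z, w) = 0` with `w'/w = 2c(L(1 - g) + (z - τ)g)`, `g = (A B' - A' B)/(A B)`, gives
`E + 2c(L(1 - g) + (z - τ)g)·D = 0` with `E = Σ h_j' w^j`, `D = Σ j h_j w^j ≠ 0` (minimality); so
`L·δ = ν` with `δ = 2c(1 - g)D ≠ 0` and `δ, ν` algebraic over `ℂ[z]` (as `w` and `g` are), whence `L`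
is algebraic over `ℂ[z]` — contradicting file II.  [folklore differential algebra, made concrete];
nothing here is specific to Schanuel's conjecture (neither used nor implied).
-/

noncomputable section

open Filter Topology Polynomial

set_option linter.dupNamespace false

namespace Summit.Schanuel.Schanuel.Theorems

/-! ## Part A. Coefficient-derivative and weighted polynomials (defined in file I) -/

/-- Pointwise evaluation of `coeffDeriv`. [folklore] -/
theorem eval_coeffDeriv (H : ℂ[X][X]) (z w : ℂ) :
    ((coeffDeriv H).map (Polynomial.evalRingHom z)).eval w =
      ∑ j ∈ Finset.range (H.natDegree + 1), (derivative (H.coeff j)).eval z * w ^ j := by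
  rw [coeffDeriv, Polynomial.map_sum, Polynomial.eval_finsetSum]
  simp only [Polynomial.map_monomial, Polynomial.eval_monomial, Polynomial.coe_evalRingHom]

/-- Pointwise evaluation of `weightDeg`. [folklore] -/
theorem eval_weightDeg (H : ℂ[X][X]) (z w : ℂ) :
    ((weightDeg H).map (Polynomial.evalRingHom z)).eval w =
      ∑ j ∈ Finset.range (H.natDegree + 1), (j : ℂ) * (H.coeff j).eval z * w ^ j := by
  rw [weightDeg, Polynomial.map_sum, Polynomial.eval_finsetSum]
  simp only [Polynomial.map_monomial, Polynomial.eval_monomial, Polynomial.coe_evalRingHom,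
    Polynomial.eval_mul, Polynomial.eval_natCast]

/-- Coefficients of `weightDeg`. [folklore] -/
theorem coeff_weightDeg (H : ℂ[X][X]) (j : ℕ) :
    (weightDeg H).coeff j = if j < H.natDegree + 1 then (j : ℂ[X]) * H.coeff j else 0 := by
  rw [weightDeg, Polynomial.finsetSum_coeff]
  simp only [Polynomial.coeff_monomial, Finset.sum_ite_eq', Finset.mem_range]

/-- **Minimality forces `Σ j h_j w^j ≠ 0`.**  If `H ≠ 0` of minimal `t`-degree kills a nonzero
`v` under `germEval₂`, then `germEval₂ v (weightDeg H) ≠ 0`. [folklore] -/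
theorem germEval₂_weightDeg_ne_zero {z₀ : ℂ} {v : AGerm z₀} (hv : v ≠ 0) {H : ℂ[X][X]} (hH0 : H ≠ 0)
    (hH : germEval₂ z₀ v H = 0)
    (hmin : ∀ Q : ℂ[X][X], Q ≠ 0 → germEval₂ z₀ v Q = 0 → H.natDegree ≤ Q.natDegree) :
    germEval₂ z₀ v (weightDeg H) ≠ 0 := by
  intro hD
  set M := H.natDegree with hM
  -- `M • H - weightDeg H` has lower degree and kills `v`, hence vanishes
  set Q : ℂ[X][X] := Polynomial.C (M : ℂ[X]) * H - weightDeg H with hQ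
  have hQev : germEval₂ z₀ v Q = 0 := by
    rw [hQ, map_sub, map_mul, hH, hD, mul_zero, sub_zero]
  have hcoefQ : ∀ j, Q.coeff j = ((M : ℂ[X]) - (j : ℂ[X])) * H.coeff j := by
    intro j
    rw [hQ, Polynomial.coeff_sub, Polynomial.coeff_C_mul, coeff_weightDeg]
    split_ifs with h
    · ring
    · rw [Polynomial.coeff_eq_zero_of_natDegree_lt (by omega : H.natDegree < j)]; ring
  have hQ0 : Q = 0 := by
    by_contra hne
    have hdeg : Q.natDegree < M := by
      rw [Polynomial.natDegree_lt_iff_degree_lt hne, Polynomial.degree_lt_iff_coeff_zero]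
      intro j hj
      rw [hcoefQ]
      rcases eq_or_lt_of_le hj with h | h
      · rw [h, sub_self, zero_mul]
      · rw [Polynomial.coeff_eq_zero_of_natDegree_lt (by omega : H.natDegree < j), mul_zero]
    exact absurd (hmin Q hne hQev) (not_le.2 hdeg)
  -- so all lower coefficients of `H` vanish: `H = h_M t^M`
  have hlow : ∀ j, j ≠ M → H.coeff j = 0 := by
    intro j hj
    have h := hcoefQ j
    rw [hQ0, Polynomial.coeff_zero] at h
    rcases mul_eq_zero.1 h.symm with h1 | h1
    · exact absurd (Nat.cast_injective (sub_eq_zero.1 h1)).symm hj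
    · exact h1
  have hHmon : H = Polynomial.monomial M (H.coeff M) := by
    refine Polynomial.ext fun j => ?_
    rw [Polynomial.coeff_monomial]
    split_ifs with h
    · rw [h]
    · exact hlow j (Ne.symm h)
  have hev : germEval₂ z₀ v (Polynomial.monomial M (H.coeff M)) = 0 := by rw [← hHmon]; exact hH
  rw [germEval₂, Polynomial.coe_eval₂RingHom, Polynomial.eval₂_monomial, Polynomial.coe_eval₂RingHom,
    ← Polynomial.aeval_def] at hev
  rcases mul_eq_zero.1 hev with h1 | h1
  · exact aeval_zGerm_ne_zero z₀ (Polynomial.leadingCoeff_ne_zero.2 hH0) h1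
  · exact pow_ne_zero M hv h1

/-! ## Part B. The transcendence theorem -/

/-- **`w = exp(κ + 2c(z - τ)L - cL²)` is transcendental over `ℂ(z)`.**  `A, B ∈ ℂ[z]` nonzero with a
point that is a root of exactly one of them; `L` analytic at `z₀` with `L' = (A B' - A' B)/(A B)`
near `z₀`; `(A B)(z₀) ≠ 0` and `(A B' - A' B)(z₀) ≠ (A B)(z₀)`; `c ≠ 0`.  Then no nonzero
`H ∈ ℂ[s][t]` has `H(z, w(z)) = 0` near `z₀`. [folklore differential algebra] (new in this form) -/
theorem not_algebraic_resonantExp {z₀ : ℂ} {A B : ℂ[X]} (hA : A ≠ 0) (hB : B ≠ 0)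
    {a : ℂ} (ha : (A.IsRoot a ∧ ¬ B.IsRoot a) ∨ (B.IsRoot a ∧ ¬ A.IsRoot a))
    {L : ℂ → ℂ} (hLan : AnalyticAt ℂ L z₀)
    (hL : ∀ᶠ z in 𝓝 z₀,
      HasDerivAt L ((A * derivative B - derivative A * B).eval z / (A * B).eval z) z)
    (h0 : (A * B).eval z₀ ≠ 0)
    (h1 : (A * derivative B - derivative A * B).eval z₀ ≠ (A * B).eval z₀)
    {c : ℂ} (hc : c ≠ 0) (τ κ : ℂ) {H : ℂ[X][X]} (hH0 : H ≠ 0)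
    (hH : ∀ᶠ z in 𝓝 z₀, (H.map (Polynomial.evalRingHom z)).eval
      (Complex.exp (κ + 2 * c * (z - τ) * L z - c * L z ^ 2)) = 0) : False := by
  set R₀ : ℂ[X] := A * B with hR₀
  set R₁ : ℂ[X] := A * derivative B - derivative A * B with hR₁
  -- the functions and their germs
  set g : ℂ → ℂ := fun z => R₁.eval z / R₀.eval z with hg
  have hgan : AnalyticAt ℂ g z₀ :=
    (analyticAt_polynomial_eval R₁ z₀).div (analyticAt_polynomial_eval R₀ z₀) h0
  set q : ℂ → ℂ := fun z => κ + 2 * c * (z - τ) * L z - c * L z ^ 2 with hq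
  have hqan : AnalyticAt ℂ q z₀ :=
    ((analyticAt_const.add ((analyticAt_const.mul (analyticAt_id.sub analyticAt_const)).mul hLan)).sub
      (analyticAt_const.mul (hLan.pow 2)))
  set w : ℂ → ℂ := fun z => Complex.exp (q z) with hw
  have hwan : AnalyticAt ℂ w z₀ := hqan.cexp
  set q' : ℂ → ℂ := fun z => 2 * c * (L z * (1 - g z) + (z - τ) * g z) with hq'
  have hq'an : AnalyticAt ℂ q' z₀ :=
    analyticAt_const.mul ((hLan.mul (analyticAt_const.sub hgan)).add
      ((analyticAt_id.sub analyticAt_const).mul hgan))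
  set wO := AGerm.mk z₀ hwan with hwO
  set LO := AGerm.mk z₀ hLan with hLO
  set gO := AGerm.mk z₀ hgan with hgO
  have hwO0 : wO ≠ 0 := AGerm.mk_ne_zero_of_forall_ne_zero hwan fun z => Complex.exp_ne_zero _
  -- a relation of minimal degree
  have hHO : germEval₂ z₀ wO H = 0 := (germEval₂_mk_eq_zero_iff hwan H).2 hH
  clear hH
  obtain ⟨H, hH0, hHO, hmin⟩ := exists_minDegree_of_exists (germEval₂ z₀ wO) ⟨H, hH0, hHO⟩
  set M := H.natDegree with hM
  -- the differentiated function identity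
  have hF : (fun z => (H.map (Polynomial.evalRingHom z)).eval (w z)) =ᶠ[𝓝 z₀] 0 :=
    (germEval₂_mk_eq_zero_iff hwan H).1 hHO
  have hR₀ev : ∀ᶠ z in 𝓝 z₀, R₀.eval z ≠ 0 :=
    (Polynomial.differentiable R₀).continuous.continuousAt.eventually_ne h0
  have hFF : ∀ᶠ z in 𝓝 z₀, (fun y => (H.map (Polynomial.evalRingHom y)).eval (w y)) =ᶠ[𝓝 z] 0 :=
    eventually_eventually_nhds.2 hF
  have hE : ∀ᶠ z in 𝓝 z₀, ((coeffDeriv H).map (Polynomial.evalRingHom z)).eval (w z) +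
      q' z * ((weightDeg H).map (Polynomial.evalRingHom z)).eval (w z) = 0 := by
    filter_upwards [hL, hR₀ev, hFF] with z hLz hR₀z hFz
    -- `q` and `w` are differentiable at `z` with `w' = w q'`
    have hqd : HasDerivAt q (q' z) z := by
      have hA1 : HasDerivAt (fun y : ℂ => y - τ) 1 z := (hasDerivAt_id z).sub_const τ
      have h1 : HasDerivAt (fun y => 2 * c * (y - τ) * L y)
          (2 * c * 1 * L z + 2 * c * (z - τ) * g z) z := (hA1.const_mul (2 * c)).fun_mul hLz
      have h2 : HasDerivAt (fun y => c * L y ^ 2) (c * (((2 : ℕ) : ℂ) * L z ^ (2 - 1) * g z)) z :=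
        (hLz.fun_pow 2).const_mul c
      have h3 := ((hasDerivAt_const z κ).fun_add h1).fun_sub h2
      refine h3.congr_deriv ?_
      rw [hq']
      norm_num
      ring
    have hwd : HasDerivAt w (w z * q' z) z := hqd.cexp
    -- derivative of `F`
    have e : (fun y => (H.map (Polynomial.evalRingHom y)).eval (w y)) =
        fun y => ∑ j ∈ Finset.range (M + 1), (H.coeff j).eval y * w y ^ j :=
      funext fun y => evalPP_eq_sum H y (w y) (Nat.lt_succ_self _)
    have hderF : HasDerivAt (fun y => (H.map (Polynomial.evalRingHom y)).eval (w y))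
        (∑ j ∈ Finset.range (M + 1), ((derivative (H.coeff j)).eval z * w z ^ j +
          (H.coeff j).eval z * ((j : ℂ) * w z ^ (j - 1) * (w z * q' z)))) z := by
      rw [e]
      exact HasDerivAt.fun_sum fun j _ => (Polynomial.hasDerivAt (H.coeff j) z).fun_mul (hwd.fun_pow j)
    have hzero := hderF.unique ((hasDerivAt_const z (0 : ℂ)).congr_of_eventuallyEq hFz)
    rw [eval_coeffDeriv, eval_weightDeg, Finset.mul_sum, ← Finset.sum_add_distrib, ← hzero]
    refine Finset.sum_congr rfl fun j _ => ?_
    rcases Nat.eq_zero_or_pos j with hj | hj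
    · subst hj; simp
    · obtain ⟨k, rfl⟩ : ∃ k, j = k + 1 := ⟨j - 1, (Nat.sub_add_cancel hj).symm⟩
      simp only [Nat.add_sub_cancel, pow_succ]
      ring
  -- the identity in the germ domain
  have hq'O : AGerm.mk z₀ hq'an =
      algebraMap ℂ (AGerm z₀) (2 * c) * (LO * (1 - gO) + (zGerm z₀ - algebraMap ℂ (AGerm z₀) τ) * gO) :=
    rfl
  have hEO : germEval₂ z₀ wO (coeffDeriv H) + AGerm.mk z₀ hq'an * germEval₂ z₀ wO (weightDeg H) = 0 := by
    have hEan : AnalyticAt ℂ (fun z => ((coeffDeriv H).map (Polynomial.evalRingHom z)).eval (w z) +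
        q' z * ((weightDeg H).map (Polynomial.evalRingHom z)).eval (w z)) z₀ :=
      (analyticAt_evalPP hwan _).add (hq'an.mul (analyticAt_evalPP hwan _))
    have h := (AGerm.mk_eq_zero_iff hEan).2 hE
    rw [germEval₂_mk, germEval₂_mk]
    exact h
  rw [hq'O] at hEO
  -- `D ≠ 0`, `1 - g ≠ 0`
  have hD : germEval₂ z₀ wO (weightDeg H) ≠ 0 := germEval₂_weightDeg_ne_zero hwO0 hH0 hHO hmin
  have h1g : (1 : AGerm z₀) - gO ≠ 0 := by
    have h1gan : AnalyticAt ℂ (fun z => 1 - g z) z₀ := analyticAt_const.sub hgan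
    have : (1 : AGerm z₀) - gO = AGerm.mk z₀ h1gan := rfl
    rw [this]
    refine AGerm.mk_ne_zero_of_apply_ne_zero h1gan ?_
    rw [hg]
    intro h
    apply h1
    field_simp at h
    linear_combination -h
  have h2c : algebraMap ℂ (AGerm z₀) (2 * c) ≠ 0 := by
    rw [Ne, map_eq_zero_iff _ (algebraMap ℂ (AGerm z₀)).injective]
    exact mul_ne_zero two_ne_zero hc
  -- `L δ = ν`
  set δ : AGerm z₀ := algebraMap ℂ (AGerm z₀) (2 * c) * (1 - gO) * germEval₂ z₀ wO (weightDeg H) with hδ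
  set ν : AGerm z₀ := -germEval₂ z₀ wO (coeffDeriv H) -
    algebraMap ℂ (AGerm z₀) (2 * c) * (zGerm z₀ - algebraMap ℂ (AGerm z₀) τ) * gO *
      germEval₂ z₀ wO (weightDeg H) with hν
  have hδ0 : δ ≠ 0 := mul_ne_zero (mul_ne_zero h2c h1g) hD
  have hLδ : δ * LO = ν := by
    rw [hδ, hν]
    linear_combination hEO
  -- algebraicity over `ℂ[zGerm]`
  set Bz := Algebra.adjoin ℂ ({zGerm z₀} : Set (AGerm z₀)) with hBz
  have hwalg : IsAlgebraic Bz wO := isAlgebraic_of_germEval₂_eq_zero wO hH0 hHO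
  have hconst : ∀ x : ℂ, IsAlgebraic Bz (algebraMap ℂ (AGerm z₀) x) := fun x => by
    rw [IsScalarTower.algebraMap_apply ℂ Bz (AGerm z₀)]
    exact isAlgebraic_algebraMap _
  have hgalg : IsAlgebraic Bz gO := by
    have hR₀O0 : Polynomial.aeval (zGerm z₀) R₀ ≠ 0 := aeval_zGerm_ne_zero z₀ (mul_ne_zero hA hB)
    refine IsAlgebraic.of_mul (mem_nonZeroDivisors_of_ne_zero hR₀O0) (isAlgebraic_aeval_zGerm z₀ R₀) ?_
    have hmul : Polynomial.aeval (zGerm z₀) R₀ * gO = Polynomial.aeval (zGerm z₀) R₁ := by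
      rw [aeval_zGerm, aeval_zGerm, hgO, ← AGerm.mk_mul]
      refine (AGerm.mk_eq_mk_iff _ _).2 ?_
      filter_upwards [hR₀ev] with z hz
      simp only [Pi.mul_apply, hg]
      field_simp
    rw [hmul]
    exact isAlgebraic_aeval_zGerm z₀ R₁
  have hzalg : IsAlgebraic Bz (zGerm z₀) := isAlgebraic_aeval_zGerm z₀ Polynomial.X |> fun h => by
    rwa [Polynomial.aeval_X] at h
  have hδalg : IsAlgebraic Bz δ :=
    ((hconst _).mul (isAlgebraic_one.sub hgalg)).mul (isAlgebraic_germEval₂ hwalg _)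
  have hνalg : IsAlgebraic Bz ν :=
    (isAlgebraic_germEval₂ hwalg _).neg.sub
      ((((hconst _).mul (hzalg.sub (hconst _))).mul hgalg).mul (isAlgebraic_germEval₂ hwalg _))
  have hLalg : IsAlgebraic Bz LO :=
    IsAlgebraic.of_mul (mem_nonZeroDivisors_of_ne_zero hδ0) hδalg (by rw [hLδ]; exact hνalg)
  -- a relation for `L`: contradiction with file II
  obtain ⟨P, hP0, hPev⟩ := exists_polyPoly_relation hLalg
  exact not_algebraic_of_hasDerivAt_logDeriv hA hB ha hLan hL h0 hP0 hPev

end Summit.Schanuel.Schanuel.Theorems
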